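import Literature.Barriers.QuantumFields.FiniteTemperaturePolyakovDiagonal
import HarnessLib

/-!
# Reflection positivity through TIME slices for general observables on
# Borgs–Seiler's finite-temperature lattice `ℤ_{L₀} × (ℤ/L)^d`

Topic `Literature/MathematicalPhysics/QuantumFieldTheory`; vocabulary of
`Literature.Barriers.QuantumFields.FiniteTemperature*` (configurations `Config d L₀ L G` on the links of
`ℤ_{L₀} × (ℤ/L)^d`, time = the `none` direction, the Wilson weight `weight ρ J_E J_M`, the a-priori measure
`haar`, the time reflection `timeReflect` (`θ t = -t`, time-like links inverted), and for an EVEN period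
`L₀ = 2n + 2` the blocks `evenPos` (links of the slices `1, …, n` and the time-like links from `t ≤ n`) and
`evenShared` (spatial links of the two fixed slices `t = 0`, `t = n + 1`) of
`FiniteTemperaturePolyakovDiagonal.lean`, where Borgs–Seiler's `⟨|Tr u|² - 1⟩ ≥ 0` is proved by this
reflection).  This file records the reflection positivity of that file for an ARBITRARY bounded measurable
observable of the closed positive half, in the shape of the tree's spatial theorems
`FiniteTemperature.integral_mul_conj_spaceReflect_mul_weight_nonneg` /
`…_spaceSiteReflect_mul_weight_nonneg` (`FiniteTemperatureSpatialReflectionPositivity.lean`), (everything proved; theorems only):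

* ★ `integral_mul_conj_timeReflect_mul_weight_nonneg` — for `L₀ = 2n + 2`, a continuous unitary `ρ`, ANY
  real `J_E, J_M`, and every bounded measurable `O : Config → ℂ` depending only on the links of
  `evenPos ∪ evenShared`:  `0 ≤ ∫ O(U) conj O(θU) e^{-S(U)} ∏dg`  (Osterwalder–Seiler reflection positivity in
  the lattice hyperplanes `t = 0`, `t = L₀/2`; the weight splits as `e^{A(U)} e^{A(θU)} e^{J_M(mag₀+mag_{n+1})}`,
  `FiniteTemperature.weight_even`, and the abstract mechanism
  `LatticeRP.integral_splice_mul_conj_comp_of_shared_nonneg` with no crossing links applies to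
  `g = O · e^{A} · e^{J_M(mag₀+mag_{n+1})/2}`);
* `weight_timeReflect`, `integral_comp_timeReflect` — the weight and the a-priori measure are `θ`-invariant
  (every `L₀`);
* (time translations — `timeTranslate`, `weight_timeTranslate`, `integral_comp_timeTranslate`, base-time independence of
  the traced Polyakov loop — are in the companion `FiniteTemperatureTimeTranslations.lean`).

These are the inputs of the Tomboulis–Yaffe chain of Appendix I of Comm. Math. Phys. 100 (1985) 313 in its
native finite-temperature setting (`L_t ≠ L_s`), carried out in the sequel files.  HONEST FRAMING: finite-volume
identities and one positivity statement; no estimate, no limit, nothing about confinement or a mass gap.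

References: C. Borgs, E. Seiler, Commun. Math. Phys. 91 (1983) 329, §II.2 (pp. 331–332); K. Osterwalder,
E. Seiler, Ann. Phys. 110 (1978) 440, §2; E. T. Tomboulis, L. G. Yaffe, Commun. Math. Phys. 100 (1985) 313,
§II (2.4)–(2.5).
-/

noncomputable section

open MeasureTheory Filter Topology
open scoped ComplexConjugate ComplexOrder
open Literature.MathematicalPhysics.QuantumFieldTheory (haarProbability)
open Literature.MathematicalPhysics.QuantumFieldTheory.LatticeRP (splice splice_apply piMeasure)

namespace Literature.Barriers.QuantumFields

namespace FiniteTemperature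

/-! ### Reflection positivity through the time slices `t = 0`, `t = L₀/2` for general observables -/

section TimeRP

variable {d n L : ℕ} [NeZero L] {G : Type*} [Group G] {N : ℕ}
variable (ρ : G →* Matrix (Fin N) (Fin N) ℂ)

/-- The plane part of the exponent is reflection invariant (`-0 = 0`, `-(n+1) = n+1`). [cite: BorgsSeiler1983, §II.2 (pp. 331–332)] -/
theorem planeExponentE_timeReflect (JM : ℝ) (U : Config d (2 * n + 2) L G) :
    planeExponentE ρ JM (timeReflect U) = planeExponentE ρ JM U := by
  unfold planeExponentE
  rw [magSlice_timeReflect, magSlice_timeReflect, neg_zero, neg_half]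

/-- The integrand `O(U) conj O(θU) e^{-S(U)}` in reflection-positive form: with
`g = O · e^{A} · e^{J_M(mag₀ + mag_{n+1})/2}` it equals `g(U) conj g(θU)` (unitary `ρ`). [cite: BorgsSeiler1983, §II.2 (pp. 331–332)] -/
theorem obs_mul_conj_mul_weight_eq_even (hρu : ∀ g, ρ g ∈ Matrix.unitaryGroup (Fin N) ℂ) (JE JM : ℝ)
    (O : Config d (2 * n + 2) L G → ℂ) (U : Config d (2 * n + 2) L G) :
    O U * conj (O (timeReflect U)) * (weight ρ JE JM U : ℂ) =
      (O U * (Real.exp (posExponentE ρ JE JM U) : ℂ) * (Real.exp (planeExponentE ρ JM U) : ℂ)) *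
        conj (O (timeReflect U) * (Real.exp (posExponentE ρ JE JM (timeReflect U)) : ℂ) *
          (Real.exp (planeExponentE ρ JM (timeReflect U)) : ℂ)) := by
  rw [weight_even ρ hρu JE JM U]
  have hM : Real.exp (JM * (magSlice ρ 0 U + magSlice ρ ((n + 1 : ℕ) : ZMod (2 * n + 2)) U)) =
      Real.exp (planeExponentE ρ JM U) * Real.exp (planeExponentE ρ JM U) := by
    rw [← Real.exp_add]
    unfold planeExponentE
    congr 1
    ring
  rw [hM, planeExponentE_timeReflect]
  simp only [map_mul, Complex.conj_ofReal]
  push_cast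
  ring

variable [TopologicalSpace G] [IsTopologicalGroup G] [CompactSpace G] [MeasurableSpace G] [BorelSpace G]
  [SecondCountableTopology G]

/-- **★ Reflection positivity through the time slices for a general observable (even period).**  For the
finite-temperature Wilson weight with a continuous unitary representation `ρ`, ANY real `J_E, J_M`, temporal
period `L₀ = 2n + 2`, and every bounded measurable observable `O` depending only on the links of the closed
positive half (`evenPos ∪ evenShared`: the slices `0, …, n + 1` with the time-like links between them),
`0 ≤ ∫ O(U) conj O(θU) e^{-S(U)} ∏dg`, `θ` the reflection `t ↦ -t` in the lattice hyperplanes `t = 0`,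
`t = n + 1`. ("The general formalism provides such a `𝒯` if the model possesses reflection positivity with
respect to reflection both in lattice planes and in planes lying half-way between lattice planes.")
[cite: BorgsSeiler1983, §II.2 (pp. 331–332)] [cite: TomboulisYaffe1985, §II.A eqs. (2.4)–(2.5) (p. 315)] -/
theorem integral_mul_conj_timeReflect_mul_weight_nonneg (hρu : ∀ g, ρ g ∈ Matrix.unitaryGroup (Fin N) ℂ)
    (hρ : Continuous ρ) (JE JM : ℝ) {O : Config d (2 * n + 2) L G → ℂ} (hOm : Measurable O) {K : ℝ}
    (hOb : ∀ U, ‖O U‖ ≤ K)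
    (hOdep : DependsOn O ((evenPos d n L ∪ ∅ ∪ evenShared d n L : Finset _) : Set _)) :
    0 ≤ ∫ U, O U * conj (O (timeReflect U)) * (weight ρ JE JM U : ℂ) ∂haar d (2 * n + 2) L G := by
  have hθm : Measurable (timeReflect : Config d (2 * n + 2) L G → Config d (2 * n + 2) L G) :=
    continuous_timeReflect.measurable
  have hconj : Measurable (starRingEnd ℂ : ℂ → ℂ) := Complex.continuous_conj.measurable
  have hwc := continuous_weight (d := d) (L₀ := 2 * n + 2) (L := L) ρ hρ JE JM
  have hFm : Measurable fun U : Config d (2 * n + 2) L G =>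
      O U * conj (O (timeReflect U)) * (weight ρ JE JM U : ℂ) :=
    (hOm.mul (hconj.comp (hOm.comp hθm))).mul (Complex.measurable_ofReal.comp hwc.measurable)
  obtain ⟨Kw, hKw⟩ := exists_forall_norm_le_of_continuous (L := L) hwc
  have hK0 : 0 ≤ K := (norm_nonneg _).trans (hOb fun _ => 1)
  have hFb : ∀ U : Config d (2 * n + 2) L G,
      ‖O U * conj (O (timeReflect U)) * (weight ρ JE JM U : ℂ)‖ ≤ K * K * Kw := by
    intro U
    rw [norm_mul, norm_mul, Complex.norm_conj, Complex.norm_real]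
    exact mul_le_mul (mul_le_mul (hOb _) (hOb _) (norm_nonneg _) hK0) (hKw U) (norm_nonneg _)
      (mul_nonneg hK0 hK0)
  -- the observable of the abstract theorem
  set g : Config d (2 * n + 2) L G → ℂ := fun U =>
    O U * (Real.exp (posExponentE ρ JE JM U) : ℂ) * (Real.exp (planeExponentE ρ JM U) : ℂ) with hg
  have hc1 : Continuous fun U : Config d (2 * n + 2) L G => posExponentE ρ JE JM U :=
    (continuous_const.mul (continuous_finsetSum _ fun _ _ => continuous_elecSlice ρ hρ _)).add
      (continuous_const.mul (continuous_finsetSum _ fun _ _ => continuous_magSlice ρ hρ _))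
  have hc2 : Continuous fun U : Config d (2 * n + 2) L G => planeExponentE ρ JM U :=
    (continuous_const.mul ((continuous_magSlice ρ hρ _).add (continuous_magSlice ρ hρ _))).div_const _
  have hgm : Measurable g :=
    (hOm.mul (Complex.measurable_ofReal.comp (Real.continuous_exp.comp hc1).measurable)).mul
      (Complex.measurable_ofReal.comp (Real.continuous_exp.comp hc2).measurable)
  obtain ⟨K₁, hK₁⟩ := exists_forall_norm_le_of_continuous (L := L) hc1
  obtain ⟨K₂, hK₂⟩ := exists_forall_norm_le_of_continuous (L := L) hc2
  have hgb : ∀ U, ‖g U‖ ≤ K * Real.exp K₁ * Real.exp K₂ := by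
    intro U
    rw [hg, norm_mul, norm_mul, Complex.norm_real, Complex.norm_real,
      Real.norm_of_nonneg (Real.exp_pos _).le, Real.norm_of_nonneg (Real.exp_pos _).le]
    have h2 : Real.exp (posExponentE ρ JE JM U) ≤ Real.exp K₁ :=
      Real.exp_le_exp.2 ((Real.le_norm_self _).trans (hK₁ U))
    have h3 : Real.exp (planeExponentE ρ JM U) ≤ Real.exp K₂ :=
      Real.exp_le_exp.2 ((Real.le_norm_self _).trans (hK₂ U))
    exact mul_le_mul (mul_le_mul (hOb U) h2 (Real.exp_pos _).le hK0) h3 (Real.exp_pos _).le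
      (mul_nonneg hK0 (Real.exp_pos _).le)
  have hgdep : DependsOn g ((evenPos d n L ∪ ∅ ∪ evenShared d n L : Finset _) : Set _) := by
    intro U V hUV
    have h1 : O U = O V := hOdep hUV
    have h2 : posExponentE ρ JE JM U = posExponentE ρ JE JM V := dependsOn_posExponentE ρ JE JM hUV
    have h3 : planeExponentE ρ JM U = planeExponentE ρ JM V := dependsOn_planeExponentE ρ JM hUV
    simp only [hg]
    rw [h1, h2, h3]
  rw [integral_eq_integral_prod_mulOn ∅ hFm hFb]
  simp_rw [mulOn_empty, obs_mul_conj_mul_weight_eq_even ρ hρu JE JM O]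
  have h := Literature.MathematicalPhysics.QuantumFieldTheory.LatticeRP.integral_splice_mul_conj_comp_of_shared_nonneg
    (haarProbability G) (evenShared d n L) (evenPos d n L) ∅ timeReflect
    measurePreserving_timeReflect (fun U e he => timeReflect_apply_of_mem_evenShared U he)
    (fun e he => dependsOn_timeReflect_apply_even he) disjoint_evenShared_evenPos
    (Finset.disjoint_empty_right _) hgm hgb hgdep
  simp_rw [splice_empty] at h
  exact h

omit [TopologicalSpace G] [IsTopologicalGroup G] [CompactSpace G] [MeasurableSpace G] [BorelSpace G]
  [SecondCountableTopology G] in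
/-- **The Wilson weight is invariant under the time reflection** (unitary `ρ`, every period `L₀`):
the electric slice sums are permuted by `t ↦ -1-t`, the magnetic ones by `t ↦ -t`. [cite: BorgsSeiler1983, §II.2 (pp. 331–332)] -/
theorem weight_timeReflect {L₀ : ℕ} [NeZero L₀] (hρu : ∀ g, ρ g ∈ Matrix.unitaryGroup (Fin N) ℂ)
    (JE JM : ℝ) (U : Config d L₀ L G) : weight ρ JE JM (timeReflect U) = weight ρ JE JM U := by
  unfold weight
  rw [minusAction_eq_sum_slices, minusAction_eq_sum_slices]
  simp_rw [elecSlice_timeReflect ρ hρu, magSlice_timeReflect]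
  rw [show (fun t : ZMod L₀ => elecSlice ρ (-1 - t) U) = fun t => elecSlice ρ ((Equiv.subLeft (-1 : ZMod L₀)) t) U
      by funext t; rfl, Equiv.sum_comp (Equiv.subLeft (-1 : ZMod L₀)) (fun t => elecSlice ρ t U),
    show (fun t : ZMod L₀ => magSlice ρ (-t) U) = fun t => magSlice ρ ((Equiv.neg (ZMod L₀)) t) U
      by funext t; rfl, Equiv.sum_comp (Equiv.neg (ZMod L₀)) (fun t => magSlice ρ t U)]

omit ρ [SecondCountableTopology G] in
/-- Change of variables by the time reflection: `∫ f(θU) ∏dg = ∫ f(U) ∏dg` (the reflection is an involution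
preserving `∏dg`). [cite: BorgsSeiler1983, §II.2 (pp. 331–332)] -/
theorem integral_comp_timeReflect {L₀ : ℕ} [NeZero L₀] {E : Type*} [NormedAddCommGroup E]
    [NormedSpace ℝ E] (f : Config d L₀ L G → E) :
    ∫ U, f (timeReflect U) ∂haar d L₀ L G = ∫ U, f U ∂haar d L₀ L G := by
  have hm := (measurePreserving_timeReflect (d := d) (L₀ := L₀) (L := L) (G := G)).measurable
  let e : Config d L₀ L G ≃ᵐ Config d L₀ L G :=
    { toFun := timeReflect, invFun := timeReflect, left_inv := fun U => timeReflect_timeReflect U,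
      right_inv := fun U => timeReflect_timeReflect U, measurable_toFun := hm, measurable_invFun := hm }
  have hmp : MeasurePreserving e (haar d L₀ L G) (haar d L₀ L G) := measurePreserving_timeReflect
  exact hmp.integral_comp' f

end TimeRP


end FiniteTemperature

end Literature.Barriers.QuantumFields

end
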